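import Summits.QuantumFields.YangMills.Theorems.UniversalDetectorReflectedKernel
import Summits.QuantumFields.YangMills.Theorems.LangevinControlUVOSLegsFromFemtoAndGapStubCollar
import Summits.QuantumFields.YangMills.Theorems.LangevinControlUVOSLegsFromFemtoAndGapStubLowerCube

/-!
# Route `UniversalDetector`, support item `PlaneLimitExtraction` (stmt-QuantumFields-23251) — mirror positivity

Ideator seat ym-idea-8 g7 (LINE 4 of rung R2a = `BalabanLadder.NT`, plane-resolved repair), sequel to
`UniversalDetectorReflectedKernel`.  The LATTICE side of the slab reflection-positivity clause of
`PlaneLimitExtraction`, on every odd torus `2L+1` at every coupling `β ≥ 0`, for the SITE reflection `Θ₀`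
(`cfgReflect` on the periodic lift = `GaugeConfig.negReflect` on the torus):
* `cov_wsum_mul_wsum` — the torus covariance is bilinear over finite WEIGHTED sums of continuous observables;
* `torusCov_cfgReflect_self_nonneg` — Osterwalder–Seiler positivity in torus form: for a bounded continuous cylinder
  observable `F` of `ℤ⁴` whose links are based at times in `[0, L−1]`, `0 ≤ E_T[F∘Θ₀ · F] − E_T[F]²`
  (tree `Cruxes.NT.ConjugateResponse.cov_negReflect_self_nonneg` + `Cruxes.NT.MarkovMirror.dependsOn_posHalf_of_window`);
* `torusCov_cfgReflect_densSum_nonneg` — the case `F = Σ_{x ∈ X} c_x dens_x` with `X ⊆ {0 ≤ x₀ ≤ L − 2}`;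
* `mirrorCov_densSum_eq_sum` / `mirrorCov_densSum_eq_sum_kernel` — that mirror form EXPANDED into the 36 plane
  kernels at the electrically shifted reflected sites (`cov_dens_mul_dens_cfgReflect_eq_sum`, `cov_plane_translate`),
  hence `kernelSum_mirror_nonneg`: the plane-kernel double sum the continuum RP integral is the limit of is `≥ 0`
  on every torus — the input of the Riemann-sum template `integral_nonneg_of_latticeDoubleSum_nonneg`;
* `abs_riemannMirror_sub_mirrorCov_le` — the lattice Riemann sum of the continuum RP pairing `Σ c_x c_y Cov_T(dens y,
  dens θx)` differs from that non-negative mirror form by at most `Σ|c_x||c_y| Σ_{pq} ε` when the plane kernels move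
  by `≤ ε` under the unit electric shifts (the input of the perturbation template
  `tendsto_latticeDoubleSum_perturbation`; under TIGHT6 it is `o(1)` as `a → 0`);
* exact lattice symmetries of the kernels: translation of density covariances (`cov_dens_translate`), evenness
  `Cov_T(dens 0, dens (−z)) = Cov_T(dens 0, dens z)` (`cov_dens_zero_neg`) and its plane-level form
  `Cov6_{pq}(−z) = Cov6_{qp}(z)` (`cov_plane_zero_neg`).
No summit, rung or crux is proved here.
-/

set_option autoImplicit false

noncomputable section

open MeasureTheory Filter Topology
open Literature.MathematicalPhysics.QuantumFieldTheory Literature.MathematicalPhysics.QuantumLattice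
  Literature.Probability.LatticeModels
open Summit.QuantumFields.YangMills.Cruxes.OSLegsFromFemtoAndGap.DlrCollarTransfer
open Summit.QuantumFields.YangMills.Cruxes.OSLegsFromFemtoAndGap.DlrCollarTransfer.StubLower (exists_abs_dens_le)
open Summit.QuantumFields.YangMills.Cruxes.NT.MarkovMirror (torusE_sum_mul dependsOn_posHalf_of_window
  continuous_cfgReflect)
open Summit.QuantumFields.YangMills.Cruxes.NT.ConjugateResponse (torusE_comp_cfgReflect cov_negReflect_self_nonneg)

namespace Summit.QuantumFields.YangMills.Cruxes.UniversalDetectorPlaneTight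

variable {G : Type} [Group G] [TopologicalSpace G] [IsTopologicalGroup G] [CompactSpace G]
  [MeasurableSpace G] [BorelSpace G] (r : LatticeRep G)

/-! ## Bilinearity over weighted finite sums -/

/-- **Covariance is bilinear over finite weighted sums of continuous observables.** -/
theorem cov_wsum_mul_wsum (β : ℝ) (L : ℕ) {ι κ : Type*} (S : Finset ι) (T : Finset κ) (a : ι → ℝ) (b : κ → ℝ)
    (f : ι → LGConfig 4 G → ℝ) (g : κ → LGConfig 4 G → ℝ) (hf : ∀ i ∈ S, Continuous (f i))
    (hg : ∀ j ∈ T, Continuous (g j)) :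
    torusE G r β L (fun V => (∑ i ∈ S, a i * f i V) * ∑ j ∈ T, b j * g j V) -
        torusE G r β L (fun V => ∑ i ∈ S, a i * f i V) * torusE G r β L (fun V => ∑ j ∈ T, b j * g j V) =
      ∑ i ∈ S, ∑ j ∈ T, a i * b j *
        (torusE G r β L (fun V => f i V * g j V) - torusE G r β L (f i) * torusE G r β L (g j)) := by
  have hre : (fun V => (∑ i ∈ S, a i * f i V) * ∑ j ∈ T, b j * g j V) =
      fun V => ∑ i ∈ S, a i * ∑ j ∈ T, b j * (f i V * g j V) := by
    funext V
    rw [Finset.sum_mul_sum]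
    refine Finset.sum_congr rfl fun i _ => ?_
    rw [Finset.mul_sum]
    refine Finset.sum_congr rfl fun j _ => ?_
    ring
  have h1 : torusE G r β L (fun V => (∑ i ∈ S, a i * f i V) * ∑ j ∈ T, b j * g j V) =
      ∑ i ∈ S, a i * ∑ j ∈ T, b j * torusE G r β L (fun V => f i V * g j V) := by
    rw [hre, torusE_sum_mul G r β L S a (fun i V => ∑ j ∈ T, b j * (f i V * g j V))
      (fun i hi => continuous_finsetSum _ fun j hj => continuous_const.mul ((hf i hi).mul (hg j hj)))]
    refine Finset.sum_congr rfl fun i hi => ?_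
    congr 1
    exact torusE_sum_mul G r β L T b (fun j V => f i V * g j V) (fun j hj => (hf i hi).mul (hg j hj))
  rw [h1, torusE_sum_mul G r β L S a f hf, torusE_sum_mul G r β L T b g hg, Finset.sum_mul_sum,
    ← Finset.sum_sub_distrib]
  refine Finset.sum_congr rfl fun i _ => ?_
  rw [Finset.mul_sum, ← Finset.sum_sub_distrib]
  refine Finset.sum_congr rfl fun j _ => ?_
  ring

/-! ## Reflection positivity of the odd torus, torus form -/

/-- **Osterwalder–Seiler positivity, torus form.**  For a bounded continuous cylinder observable `F` of `ℤ⁴` whose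
links are based at times in `[0, L−1]`, on the torus `2L+1` (`L ≥ 1`) at `β ≥ 0`:
`0 ≤ E_T[F∘Θ₀ · F] − E_T[F]²`. [cite: OsterwalderSeiler1978, §2] -/
theorem torusCov_cfgReflect_self_nonneg {β : ℝ} (hβ : 0 ≤ β) {L : ℕ} (hL : 1 ≤ L) {F : LGConfig 4 G → ℝ}
    (hFc : Continuous F) {MF : ℝ} (hMF : ∀ U, |F U| ≤ MF)
    {SF : Finset (Literature.MathematicalPhysics.QuantumLattice.ZdEdge 4)} (hFS : IsCylinder F SF)
    (hSF : ∀ e ∈ SF, 0 ≤ e.1 0 ∧ e.1 0 + 1 ≤ (L : ℤ)) :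
    0 ≤ torusE G r β L (fun V => F (cfgReflect V) * F V) - torusE G r β L F ^ 2 := by
  haveI := r.secondCountableTopology
  have hpos := dependsOn_posHalf_of_window (G := G) L hFS hSF
  have hFm : Measurable fun U : GaugeConfig 4 (2 * L + 1) G => F (torusLift (2 * L + 1) U) :=
    (hFc.comp (continuous_torusLift _)).measurable
  have key := cov_negReflect_self_nonneg r.ρ hL r.continuous hβ hFm ⟨MF, fun U => hMF _⟩ hpos
  unfold torusE
  simp only [torusLift_negReflect] at key
  exact key

/-- **Mirror positivity of density-smeared observables.**  For `F = Σ_{x ∈ X} c_x dens_x` with every `x ∈ X` in the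
time window `0 ≤ x₀ ≤ L − 2`: `0 ≤ E_T[F∘Θ₀ · F] − E_T[F]²` on the torus `2L+1` at `β ≥ 0`.
[cite: OsterwalderSeiler1978, §2] -/
theorem torusCov_cfgReflect_densSum_nonneg {β : ℝ} (hβ : 0 ≤ β) {L : ℕ} (hL : 1 ≤ L) (X : Finset (Site 4))
    (c : Site 4 → ℝ) (hX : ∀ x ∈ X, 0 ≤ x 0 ∧ x 0 + 2 ≤ (L : ℤ)) :
    0 ≤ torusE G r β L (fun V => (∑ x ∈ X, c x * dens G r x (cfgReflect V)) * ∑ x ∈ X, c x * dens G r x V) -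
      torusE G r β L (fun V => ∑ x ∈ X, c x * dens G r x V) ^ 2 := by
  classical
  obtain ⟨C, -, hC⟩ := exists_abs_dens_le G r
  refine torusCov_cfgReflect_self_nonneg r hβ hL (F := fun V => ∑ x ∈ X, c x * dens G r x V)
    (continuous_finsetSum _ fun x _ => continuous_const.mul (continuous_dens r x))
    (MF := ∑ x ∈ X, |c x| * C) (fun U => ?_)
    (SF := X.biUnion fun x => r.curvature.supp.image fun e => (e.1 - -x, e.2)) ?_ ?_
  · calc |∑ x ∈ X, c x * dens G r x U| ≤ ∑ x ∈ X, |c x * dens G r x U| := Finset.abs_sum_le_sum_abs _ _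
      _ ≤ ∑ x ∈ X, |c x| * C := Finset.sum_le_sum fun x _ => by
          rw [abs_mul]; exact mul_le_mul_of_nonneg_left (hC x U) (abs_nonneg _)
  · intro U V hUV
    show ∑ x ∈ X, c x * dens G r x U = ∑ x ∈ X, c x * dens G r x V
    refine Finset.sum_congr rfl fun x hx => ?_
    rw [isCylinder_dens r x (fun e he => hUV e (Finset.mem_coe.2 (Finset.mem_biUnion.2 ⟨x, hx, he⟩)))]
  · intro e he
    obtain ⟨x, hx, hex⟩ := Finset.mem_biUnion.1 he
    have h0 := near_of_mem_supp_dens r hex 0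
    have h1 := hX x hx
    constructor <;> omega

/-! ## The mirror form of a smeared density in plane-kernel form -/

/-- **Expansion of the mirror form of `F = Σ c_x dens_x` into plane kernels**:
`E_T[F∘Θ₀ · F] − E_T[F]² = Σ_{x,y} c_x c_y Σ_{p,q} Cov_T(plane p y, plane q (σ_q θx))`. -/
theorem mirrorCov_densSum_eq_sum (β : ℝ) (L : ℕ) (X : Finset (Site 4)) (c : Site 4 → ℝ) :
    torusE G r β L (fun V => (∑ x ∈ X, c x * dens G r x (cfgReflect V)) * ∑ x ∈ X, c x * dens G r x V) -
        torusE G r β L (fun V => ∑ x ∈ X, c x * dens G r x V) ^ 2 =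
      ∑ x ∈ X, ∑ y ∈ X, c x * c y *
        ∑ p : {q : Fin 4 × Fin 4 // q.1 < q.2}, ∑ q : {q : Fin 4 × Fin 4 // q.1 < q.2},
          (torusE G r β L (fun V => plane G r p.1 y V *
              plane G r q.1 (if q.1.1 = 0 then siteReflect x - Pi.single 0 1 else siteReflect x) V) -
            torusE G r β L (plane G r p.1 y) *
              torusE G r β L (plane G r q.1 (if q.1.1 = 0 then siteReflect x - Pi.single 0 1 else siteReflect x))) := by
  have hΘ : torusE G r β L (fun V => ∑ x ∈ X, c x * dens G r x (cfgReflect V)) =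
      torusE G r β L (fun V => ∑ x ∈ X, c x * dens G r x V) :=
    torusE_comp_cfgReflect G r β L (fun W => ∑ x ∈ X, c x * dens G r x W)
  calc torusE G r β L (fun V => (∑ x ∈ X, c x * dens G r x (cfgReflect V)) * ∑ x ∈ X, c x * dens G r x V) -
        torusE G r β L (fun V => ∑ x ∈ X, c x * dens G r x V) ^ 2
      = torusE G r β L (fun V => (∑ x ∈ X, c x * dens G r x (cfgReflect V)) * ∑ x ∈ X, c x * dens G r x V) -
          torusE G r β L (fun V => ∑ x ∈ X, c x * dens G r x (cfgReflect V)) *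
            torusE G r β L (fun V => ∑ x ∈ X, c x * dens G r x V) := by rw [hΘ, sq]
    _ = ∑ x ∈ X, ∑ y ∈ X, c x * c y *
          (torusE G r β L (fun V => dens G r x (cfgReflect V) * dens G r y V) -
            torusE G r β L (fun V => dens G r x (cfgReflect V)) * torusE G r β L (dens G r y)) :=
        cov_wsum_mul_wsum r β L X X c c (fun x V => dens G r x (cfgReflect V)) (fun y => dens G r y)
          (fun x _ => (continuous_dens r x).comp continuous_cfgReflect) (fun y _ => continuous_dens r y)
    _ = _ := by
        refine Finset.sum_congr rfl fun x _ => Finset.sum_congr rfl fun y _ => ?_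
        congr 1
        have hc : (fun V => dens G r x (cfgReflect V) * dens G r y V) =
            fun V => dens G r y V * dens G r x (cfgReflect V) := funext fun V => mul_comm _ _
        rw [torusE_comp_cfgReflect G r β L (dens G r x), hc,
          mul_comm (torusE G r β L (dens G r x)) (torusE G r β L (dens G r y))]
        exact cov_dens_mul_dens_cfgReflect_eq_sum r β L y x

/-- **Kernel form**: the same mirror form with every plane covariance translated to the origin,
`Cov_T(plane p y, plane q (σ_q θx)) = Cov6_{pq}(σ_q θx − y)`. -/
theorem mirrorCov_densSum_eq_sum_kernel (β : ℝ) (L : ℕ) (X : Finset (Site 4)) (c : Site 4 → ℝ) :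
    torusE G r β L (fun V => (∑ x ∈ X, c x * dens G r x (cfgReflect V)) * ∑ x ∈ X, c x * dens G r x V) -
        torusE G r β L (fun V => ∑ x ∈ X, c x * dens G r x V) ^ 2 =
      ∑ x ∈ X, ∑ y ∈ X, c x * c y *
        ∑ p : {q : Fin 4 × Fin 4 // q.1 < q.2}, ∑ q : {q : Fin 4 × Fin 4 // q.1 < q.2},
          (torusE G r β L (fun V => plane G r p.1 0 V *
              plane G r q.1 ((if q.1.1 = 0 then siteReflect x - Pi.single 0 1 else siteReflect x) - y) V) -
            torusE G r β L (plane G r p.1 0) *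
              torusE G r β L (plane G r q.1 ((if q.1.1 = 0 then siteReflect x - Pi.single 0 1 else siteReflect x) - y))) := by
  rw [mirrorCov_densSum_eq_sum]
  refine Finset.sum_congr rfl fun x _ => Finset.sum_congr rfl fun y _ => ?_
  congr 1
  refine Finset.sum_congr rfl fun p _ => Finset.sum_congr rfl fun q _ => ?_
  exact cov_plane_translate r β L p.1 q.1 y _

/-- **The plane-kernel double sum of the mirror form is non-negative** on every torus `2L+1` (`L ≥ 1`, `β ≥ 0`)
for coefficients carried by the time window `0 ≤ x₀ ≤ L − 2` — the lattice inequality whose Riemann-sum limit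
is the slab reflection positivity of the limit kernel. [cite: OsterwalderSeiler1978, §2] -/
theorem kernelSum_mirror_nonneg {β : ℝ} (hβ : 0 ≤ β) {L : ℕ} (hL : 1 ≤ L) (X : Finset (Site 4))
    (c : Site 4 → ℝ) (hX : ∀ x ∈ X, 0 ≤ x 0 ∧ x 0 + 2 ≤ (L : ℤ)) :
    0 ≤ ∑ x ∈ X, ∑ y ∈ X, c x * c y *
        ∑ p : {q : Fin 4 × Fin 4 // q.1 < q.2}, ∑ q : {q : Fin 4 × Fin 4 // q.1 < q.2},
          (torusE G r β L (fun V => plane G r p.1 0 V *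
              plane G r q.1 ((if q.1.1 = 0 then siteReflect x - Pi.single 0 1 else siteReflect x) - y) V) -
            torusE G r β L (plane G r p.1 0) *
              torusE G r β L (plane G r q.1 ((if q.1.1 = 0 then siteReflect x - Pi.single 0 1 else siteReflect x) - y))) := by
  rw [← mirrorCov_densSum_eq_sum_kernel]
  exact torusCov_cfgReflect_densSum_nonneg r hβ hL X c hX

/-! ## Exact lattice symmetries of the kernels: translations and evenness -/

/-- The density at `w` is the density at `w − u` of the configuration translated by `−u`. -/
theorem dens_configShift_neg (u w : Site 4) (V : LGConfig 4 G) :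
    dens G r (w - u) (configShift (-u) V) = dens G r w V := by
  unfold dens
  congr 1
  funext e
  simp only [Literature.MathematicalPhysics.QuantumLattice.configShift_apply]
  congr 2
  ext i
  simp only [Pi.sub_apply, Pi.neg_apply]
  ring

/-- **Translation of density covariances**: `Cov_T(dens u, dens w) = Cov_T(dens 0, dens (w − u))`. -/
theorem cov_dens_translate (β : ℝ) (L : ℕ) (u w : Site 4) :
    torusE G r β L (fun V => dens G r u V * dens G r w V) - torusE G r β L (dens G r u) * torusE G r β L (dens G r w) =
      torusE G r β L (fun V => dens G r 0 V * dens G r (w - u) V) -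
        torusE G r β L (dens G r 0) * torusE G r β L (dens G r (w - u)) := by
  have e2 : ∀ V, dens G r u V = dens G r 0 (configShift (-u) V) := fun V => by
    have h := dens_configShift_neg r u u V
    rw [sub_self] at h
    exact h.symm
  have e3 : ∀ V, dens G r w V = dens G r (w - u) (configShift (-u) V) := fun V =>
    (dens_configShift_neg r u w V).symm
  have h1 : (fun V => dens G r u V * dens G r w V) =
      fun V => dens G r 0 (configShift (-u) V) * dens G r (w - u) (configShift (-u) V) := by
    funext V; rw [e2, e3]
  have h2 : dens G r u = fun V => dens G r 0 (configShift (-u) V) := funext e2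
  have h3 : dens G r w = fun V => dens G r (w - u) (configShift (-u) V) := funext e3
  rw [h1, torusE_configShift_neg r β L (fun W => dens G r 0 W * dens G r (w - u) W) u, h2,
    torusE_configShift_neg r β L (dens G r 0) u, h3, torusE_configShift_neg r β L (dens G r (w - u)) u]

/-- **Plane-level evenness**: `Cov_T(plane p 0, plane q (−z)) = Cov_T(plane q 0, plane p z)`, i.e.
`Cov6_{pq}(−z) = Cov6_{qp}(z)`. -/
theorem cov_plane_zero_neg (β : ℝ) (L : ℕ) (p q : Fin 4 × Fin 4) (z : Site 4) :
    torusE G r β L (fun V => plane G r p 0 V * plane G r q (-z) V) - torusE G r β L (plane G r p 0) * torusE G r β L (plane G r q (-z)) =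
      torusE G r β L (fun V => plane G r q 0 V * plane G r p z V) -
        torusE G r β L (plane G r q 0) * torusE G r β L (plane G r p z) := by
  have h := cov_plane_translate r β L p q z 0
  rw [zero_sub] at h
  rw [← h]
  have hc : (fun V => plane G r p z V * plane G r q 0 V) = fun V => plane G r q 0 V * plane G r p z V :=
    funext fun V => mul_comm _ _
  rw [hc, mul_comm (torusE G r β L (plane G r p z)) (torusE G r β L (plane G r q 0))]

/-- **Evenness of the density kernel**: `Cov_T(dens 0, dens (−z)) = Cov_T(dens 0, dens z)` (exact, every torus). -/
theorem cov_dens_zero_neg (β : ℝ) (L : ℕ) (z : Site 4) :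
    torusE G r β L (fun V => dens G r 0 V * dens G r (-z) V) - torusE G r β L (dens G r 0) * torusE G r β L (dens G r (-z)) =
      torusE G r β L (fun V => dens G r 0 V * dens G r z V) - torusE G r β L (dens G r 0) * torusE G r β L (dens G r z) := by
  rw [cov_dens_zero_eq_sum, cov_dens_zero_eq_sum, Finset.sum_comm]
  exact Finset.sum_congr rfl fun q _ => Finset.sum_congr rfl fun p _ => cov_plane_zero_neg r β L p.1 q.1 z

/-- **Evenness of the density covariance in two-site form**: `Cov_T(dens u, dens w) = Cov_T(dens w, dens u)` read at
the origin, `Cov_T(dens 0, dens (w − u)) = Cov_T(dens 0, dens (u − w))`. -/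
theorem cov_dens_zero_sub_comm (β : ℝ) (L : ℕ) (u w : Site 4) :
    torusE G r β L (fun V => dens G r 0 V * dens G r (w - u) V) - torusE G r β L (dens G r 0) * torusE G r β L (dens G r (w - u)) =
      torusE G r β L (fun V => dens G r 0 V * dens G r (u - w) V) -
        torusE G r β L (dens G r 0) * torusE G r β L (dens G r (u - w)) := by
  rw [← neg_sub u w, cov_dens_zero_neg]


/-! ## The Riemann sum of the reflected pairing versus the mirror form -/

/-- **Riemann-sum form versus mirror form.**  The lattice Riemann sum of the continuum RP pairing,
`Σ_{x,y} c_x c_y Cov_T(dens y, dens θx) = Σ c_x c_y Σ_{p,q} Cov6_{pq}(θx − y)`, differs from the (non-negative) mirror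
form `E_T[F∘Θ₀·F] − E_T[F]² = Σ c_x c_y Σ_{p,q} Cov6_{pq}(σ_q θx − y)` only through the unit electric shifts: if each
plane kernel moves by at most `ε x y p q` between the two arguments, the two quantities differ by at most
`Σ_{x,y} |c_x| |c_y| Σ_{p,q} ε x y p q` (under TIGHT6 at slab-separated arguments: `≤ (Σ|c|)² · Σ_{pq} ω_{pq}(a) → 0`). -/
theorem abs_riemannMirror_sub_mirrorCov_le (β : ℝ) (L : ℕ) (X : Finset (Site 4)) (c : Site 4 → ℝ)
    (ε : Site 4 → Site 4 → {q : Fin 4 × Fin 4 // q.1 < q.2} → {q : Fin 4 × Fin 4 // q.1 < q.2} → ℝ)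
    (hε : ∀ x ∈ X, ∀ y ∈ X, ∀ p q : {q : Fin 4 × Fin 4 // q.1 < q.2},
      |(torusE G r β L (fun V => plane G r p.1 0 V * plane G r q.1 (siteReflect x - y) V) -
          torusE G r β L (plane G r p.1 0) * torusE G r β L (plane G r q.1 (siteReflect x - y))) -
        (torusE G r β L (fun V => plane G r p.1 0 V *
            plane G r q.1 ((if q.1.1 = 0 then siteReflect x - Pi.single 0 1 else siteReflect x) - y) V) -
          torusE G r β L (plane G r p.1 0) *
            torusE G r β L (plane G r q.1 ((if q.1.1 = 0 then siteReflect x - Pi.single 0 1 else siteReflect x) - y)))|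
        ≤ ε x y p q) :
    |(∑ x ∈ X, ∑ y ∈ X, c x * c y *
        (torusE G r β L (fun V => dens G r y V * dens G r (siteReflect x) V) -
          torusE G r β L (dens G r y) * torusE G r β L (dens G r (siteReflect x)))) -
      (torusE G r β L (fun V => (∑ x ∈ X, c x * dens G r x (cfgReflect V)) * ∑ x ∈ X, c x * dens G r x V) -
        torusE G r β L (fun V => ∑ x ∈ X, c x * dens G r x V) ^ 2)| ≤
      ∑ x ∈ X, ∑ y ∈ X, |c x| * |c y| * ∑ p : {q : Fin 4 × Fin 4 // q.1 < q.2},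
        ∑ q : {q : Fin 4 × Fin 4 // q.1 < q.2}, ε x y p q := by
  rw [mirrorCov_densSum_eq_sum_kernel, ← Finset.sum_sub_distrib]
  refine (Finset.abs_sum_le_sum_abs _ _).trans (Finset.sum_le_sum fun x hx => ?_)
  rw [← Finset.sum_sub_distrib]
  refine (Finset.abs_sum_le_sum_abs _ _).trans (Finset.sum_le_sum fun y hy => ?_)
  rw [cov_dens_translate r β L y (siteReflect x), cov_dens_zero_eq_sum r β L (siteReflect x - y), ← mul_sub,
    abs_mul, abs_mul]
  refine mul_le_mul_of_nonneg_left ?_ (by positivity)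
  rw [← Finset.sum_sub_distrib]
  refine (Finset.abs_sum_le_sum_abs _ _).trans (Finset.sum_le_sum fun p _ => ?_)
  rw [← Finset.sum_sub_distrib]
  exact (Finset.abs_sum_le_sum_abs _ _).trans (Finset.sum_le_sum fun q _ => hε x hx y hy p q)

end Summit.QuantumFields.YangMills.Cruxes.UniversalDetectorPlaneTight

end
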